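import Summits.QuantumFields.GaugeBoot.TorusLatticePoincare
import Summits.QuantumFields.GaugeBoot.ZdCentralTwistGaugeEquivalence
import Summits.QuantumFields.GaugeBoot.CubicTorusLinkRPAnyBeta
import HarnessLib

/-!
# Kogut–Susskind staggerings of the torus `(ℤ/L)^d`: the `2^d` gauge classes, labelled by the cycle
# holonomies (gauge-boot, L3 structural supplement; `ℤ^d` twist 13)

HONEST FRAMING (cell `pub-gaugeboot`, page 1 of every file): the venture produces certified bounds
on lattice expectations at stated coupling, gauge group, dimension and torus size; NOT a mass gap,
NOT a continuum limit, NOT a string tension; NOT Yang–Mills-summit-bearing (barriers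
`FixedCouplingUltralocality`, `PerturbativeInvisibility`). This module bounds no expectation; no
certificate of the cell sits at `β < 0`. Structural bookkeeping: WHICH central twists `β ↦ -β` the
even torus carries, and how far the choice matters.

`ZdCentralTwistGaugeEquivalence.lean` (twist 11): on the infinite lattice any two `{1, z}`-valued
Kogut–Susskind staggerings are gauge equivalent (`H¹(ℤ^d; ℤ/2) = 0`). On the torus `H¹ ≠ 0`, and the
statement becomes a classification. A `ℤ/2`-cochain `c : TorusSite d L → Fin d → ℤ/2` with link weights
`cochainTwist z c (y, i) = z^{c(y; i)}` is a **Kogut–Susskind cochain** (`IsTorusKSCochain c`) when its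
sum around every plaquette is `1` — exactly the `{1, z}`-valued staggerings of the cubic torus
(`IsTorusKSCochain.isStaggering`; for `SU(2)`, `SU(2n)`, `U(N)` these are all staggerings); the parity
cochain `stagParity (cubicParity d L _) r` of an EVEN torus is one (`isTorusKSCochain_stagParity`). Then,
with the torus Poincaré lemma (`TorusLatticePoincare.lean`):

* `IsTorusKSCochain.add` — two KS cochains differ by a CLOSED cochain, hence (Poincaré) by a
  coboundary plus coordinate sheets; `centralTwist_cochainTwist_td₀` — **the twist by `z^{td₀ φ}` IS the
  torus gauge transformation by `z^{φ}`** (`gaugeTransform` of the tree); `centralTwist_cochainTwist_add`;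
* ★★ `IsTorusKSCochain.exists_gauge_of_cycleHolonomy_eq_zero` — **two KS staggerings whose difference
  has trivial cycle holonomies are gauge equivalent**: `T₁ = g ∘ T₂`, `g` central-valued; ★★
  `IsTorusKSCochain.cycleHolonomy_eq_zero_of_gauge` — **conversely** (`z ≠ 1`): a gauge equivalence
  `T₁ U = (T₂ U)^g` forces all `d` cycle holonomies of `c₁ + c₂` to vanish (evaluate at `U = 1` and
  multiply once around each coordinate cycle); ★★★ `IsTorusKSCochain.gauge_iff` — the iff;
* `cycleHolonomy_stagParity` — the parity cochain has TRIVIAL holonomies; `isTorusKSCochain_sector` —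
  `stagParity + ∑_m sheet m (ε m)` is a KS cochain with holonomies `ε` relative to the parity cochain:
  **all `2^d` classes occur, and every KS cochain is gauge equivalent to exactly one of these**
  (`IsTorusKSCochain.exists_gauge_sector`, `sector_unique`);
* `IsTorusKSCochain.apply_centralTwist_eq` — gauge-invariant observables of the torus do not
  distinguish KS staggerings of the same class.

What is NOT claimed: which loops detect the class is the sequel `TorusKSCochainsLoops.lean`
(contractible loops: none; Polyakov lines: all); staggerings with values outside `{1, z}` (groups whose
centre has several involutions) are not treated; nothing about measures here; odd `L` carries no KS
cochain at all when `d ≥ 2` (not proved here). [folklore] bookkeeping (Kogut–Susskind 1975; twisted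
boundary conditions / flux sectors: 't Hooft 1979).
-/

noncomputable section

open Literature.Probability.LatticeModels (Site TorusSite Torus.proj)
open Literature.MathematicalPhysics.QuantumFieldTheory (GaugeConfig gaugeTransform IsGaugeInvariant
  LatticeForm.td₀)
open Literature.MathematicalPhysics.QuantumLattice

namespace Summit.QuantumFields.GaugeBoot

namespace TiltedRP

open TorusPoincare

variable {d L N : ℕ} {G : Type*} [Group G]

/-! ## Kogut–Susskind cochains of the torus and their link weights -/

section KS

/-- **The link weights of a `ℤ/2`-cochain**: `cochainTwist z c (y, i) = z^{c(y; i)}` (any site type). -/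
def cochainTwist {X : Type*} (z : G) (c : X → Fin d → ZMod 2) : Link X d → G :=
  fun l => zpow₂ z (c l.1 l.2)

/-- `cochainTwist` evaluated. -/
@[simp] theorem cochainTwist_apply {X : Type*} (z : G) (c : X → Fin d → ZMod 2) (l : Link X d) :
    cochainTwist z c l = zpow₂ z (c l.1 l.2) := rfl

/-- **A Kogut–Susskind `ℤ/2`-cochain of the torus `(ℤ/L)^d`**: the sum around every plaquette is `1`
(the sign rule `η₁ + η₂ + η₃ + η₄ = 1`). [shape] A hypothesis (a `Prop`), asserting nothing. [folklore] -/
def IsTorusKSCochain (c : TorusSite d L → Fin d → ZMod 2) : Prop :=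
  ∀ (y : TorusSite d L) (k l : Fin d), k ≠ l →
    c y k + c (y + Pi.single k 1) l + c (y + Pi.single l 1) k + c y l = 1

variable {z : G}

/-- **A KS cochain defines a staggering of the cubic torus with values in `{1, z}`.** -/
theorem IsTorusKSCochain.isStaggering {c : TorusSite d L → Fin d → ZMod 2} (hc : IsTorusKSCochain c)
    (hzc : ∀ g : G, z * g = g * z) (hz2 : z * z = 1) :
    IsStaggering (cubicUnit d L) z (cochainTwist z c) where
  comm l g := zpow₂_comm hzc _ g
  mul_self l := zpow₂_mul_self hz2 _
  plaq x k l hkl := by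
    simp only [cochainTwist_apply]
    rw [← zpow₂_add hz2, ← zpow₂_add hz2, ← zpow₂_add hz2]
    have h := hc x k l hkl
    simp only [cubicUnit] at h ⊢
    rw [h]
    simp [zpow₂]

/-- **The parity cochain of an even torus is a KS cochain** (`stagParity_plaquette`). -/
theorem isTorusKSCochain_stagParity (h2 : 2 ∣ L) (r : Fin d) :
    IsTorusKSCochain (fun y i => stagParity (cubicParity d L h2) r (y, i)) := by
  intro y k l hkl
  have h := stagParity_plaquette (isDualParity_cubicParity d L h2) r y hkl
  simpa [cubicUnit] using h

/-- The parity staggering is the twist by the parity cochain. -/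
theorem cochainTwist_stagParity (h2 : 2 ∣ L) (r : Fin d) (z : G) :
    cochainTwist z (fun y i => stagParity (cubicParity d L h2) r (y, i)) =
      stagTwist (cubicParity d L h2) r z := rfl

/-- **Two KS cochains differ by a closed cochain** (over `ℤ/2` the two sign rules add up to `0`). -/
theorem IsTorusKSCochain.add {c₁ c₂ : TorusSite d L → Fin d → ZMod 2} (h₁ : IsTorusKSCochain c₁)
    (h₂ : IsTorusKSCochain c₂) : IsClosed (c₁ + c₂) := by
  intro y k l
  simp only [Pi.add_apply]
  rcases eq_or_ne k l with rfl | hkl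
  · abel
  have key : ∀ a b c e a' b' c' e' : ZMod 2, a + b + c + e = 1 → a' + b' + c' + e' = 1 →
      a + a' + (b + b') - (c + c') - (e + e') = 0 := by decide
  exact key _ _ _ _ _ _ _ _ (h₁ y k l hkl) (h₂ y k l hkl)

/-- **A KS cochain plus a closed cochain is a KS cochain** (the KS cochains form a torsor under the
closed ones). -/
theorem IsTorusKSCochain.add_isClosed {c b : TorusSite d L → Fin d → ZMod 2} (hc : IsTorusKSCochain c)
    (hb : IsClosed b) : IsTorusKSCochain (c + b) := by
  intro y k l hkl
  simp only [Pi.add_apply]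
  have key : ∀ a b' c e a' b'' c' e' : ZMod 2, a + b' + c + e = 1 → a' + b'' - c' - e' = 0 →
      a + a' + (b' + b'') + (c + c') + (e + e') = 1 := by decide
  exact key _ _ _ _ _ _ _ _ (hc y k l hkl) (hb y k l)

end KS

/-! ## Coboundaries twist by gauge transformations -/

section Gauge

variable {z : G}

/-- **The twist by `z^{td₀ φ}` is the torus gauge transformation by `z^{φ}`** (central values). -/
theorem centralTwist_cochainTwist_td₀ (hzc : ∀ g : G, z * g = g * z) (hz2 : z * z = 1)
    (φ : TorusSite d L → ZMod 2) (U : GaugeConfig d L G) :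
    centralTwist (cochainTwist z (LatticeForm.td₀ φ)) U = gaugeTransform (fun y => zpow₂ z (φ y)) U := by
  funext l
  obtain ⟨y, i⟩ := l
  rw [centralTwist_apply, cochainTwist_apply, TorusPoincare.td₀_apply]
  simp only [gaugeTransform, Literature.MathematicalPhysics.QuantumFieldTheory.Site.shift]
  rw [zpow₂_inv hz2, mul_assoc, ← zpow₂_comm hzc, ← mul_assoc, ← zpow₂_add hz2]
  congr 2
  rw [sub_eq_add_neg, ZMod.neg_eq_self_mod_two, add_comm]

/-- **Twists compose additively**: `T_{b + c} = T_b ∘ T_c`. -/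
theorem centralTwist_cochainTwist_add (hz2 : z * z = 1) (b c : TorusSite d L → Fin d → ZMod 2)
    (U : GaugeConfig d L G) :
    centralTwist (cochainTwist z (b + c)) U =
      centralTwist (cochainTwist z b) (centralTwist (cochainTwist z c) U) := by
  funext l
  simp only [centralTwist_apply, cochainTwist_apply, Pi.add_apply, zpow₂_add hz2, mul_assoc]

/-- In characteristic two `c₁ = (c₁ + c₂) + c₂`. -/
theorem eq_add_add_self (c₁ c₂ : TorusSite d L → Fin d → ZMod 2) : c₁ = (c₁ + c₂) + c₂ := by
  funext y i
  have h : ∀ a b : ZMod 2, a = a + b + b := by decide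
  exact h _ _

/-- ★★ **KS staggerings with the same cycle holonomies are gauge equivalent**: if the `d` cycle
holonomies of `c₁ + c₂` vanish then `T₁ = g ∘ T₂` with `g = z^{φ}` central-valued (`L ≥ 1`). -/
theorem IsTorusKSCochain.exists_gauge_of_cycleHolonomy_eq_zero [NeZero L]
    {c₁ c₂ : TorusSite d L → Fin d → ZMod 2} (h₁ : IsTorusKSCochain c₁) (h₂ : IsTorusKSCochain c₂)
    (hzc : ∀ g : G, z * g = g * z) (hz2 : z * z = 1) (h0 : ∀ m, cycleHolonomy (c₁ + c₂) m = 0) :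
    ∃ k : TorusSite d L → G, (∀ y g, k y * g = g * k y) ∧
      ∀ U : GaugeConfig d L G, centralTwist (cochainTwist z c₁) U =
        gaugeTransform k (centralTwist (cochainTwist z c₂) U) := by
  obtain ⟨φ, hφ⟩ := exists_td₀_of_cycleHolonomy_eq_zero (h₁.add h₂) h0
  refine ⟨fun y => zpow₂ z (φ y), fun y g => zpow₂_comm hzc _ g, fun U => ?_⟩
  rw [← centralTwist_cochainTwist_td₀ hzc hz2, hφ, ← centralTwist_cochainTwist_add hz2,
    ← eq_add_add_self]

/-- `∏_{u<t} z^{a_u}` telescoped: if `z^{a(y;i)} = k(y) · k(y + eᵢ)⁻¹` on every link then along the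
coordinate cycle `z^{∑_{u<t} a(u e_m; m)} = k(0) · k(t e_m)⁻¹`. -/
theorem zpow₂_sum_range_eq_of_link (hzc : ∀ g : G, z * g = g * z) (hz2 : z * z = 1)
    {a : TorusSite d L → Fin d → ZMod 2} {k : TorusSite d L → G}
    (hk : ∀ (y : TorusSite d L) (i : Fin d), zpow₂ z (a y i) = k y * (k (y + Pi.single i 1))⁻¹)
    (m : Fin d) : ∀ t : ℕ,
      zpow₂ z (∑ u ∈ Finset.range t, a (Pi.single m (u : ZMod L)) m) =
        k 0 * (k (Pi.single m (t : ZMod L)))⁻¹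
  | 0 => by simp [zpow₂]
  | t + 1 => by
    rw [Finset.sum_range_succ, zpow₂_add hz2, zpow₂_sum_range_eq_of_link hzc hz2 hk m t, hk,
      ← Pi.single_add, ← Nat.cast_succ, mul_assoc, inv_mul_cancel_left]

/-- ★★ **Conversely, a gauge equivalence forces equal cycle holonomies** (`z ≠ 1`, `L ≥ 1`): if
`T₁ U = (T₂ U)^k` for every configuration `U` (any gauge function `k`), then every cycle holonomy of
`c₁ + c₂` vanishes — evaluate at `U = 1`, so that `z^{(c₁+c₂)(y;i)} = k(y) k(y+eᵢ)⁻¹`, and multiply once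
around the coordinate cycle. -/
theorem IsTorusKSCochain.cycleHolonomy_eq_zero_of_gauge [NeZero L]
    {c₁ c₂ : TorusSite d L → Fin d → ZMod 2} (hzc : ∀ g : G, z * g = g * z) (hz2 : z * z = 1)
    (hz1 : z ≠ 1) {k : TorusSite d L → G}
    (hk : ∀ U : GaugeConfig d L G, centralTwist (cochainTwist z c₁) U =
      gaugeTransform k (centralTwist (cochainTwist z c₂) U)) (m : Fin d) :
    cycleHolonomy (c₁ + c₂) m = 0 := by
  -- on the trivial configuration: `z^{c₁(l)} = k(y) z^{c₂(l)} k(y+e)⁻¹`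
  have hlink : ∀ (y : TorusSite d L) (i : Fin d),
      zpow₂ z ((c₁ + c₂) y i) = k y * (k (y + Pi.single i 1))⁻¹ := by
    intro y i
    have h := congrFun (hk (fun _ => 1)) (y, i)
    simp only [centralTwist_apply, cochainTwist_apply, mul_one, gaugeTransform,
      Literature.MathematicalPhysics.QuantumFieldTheory.Site.shift] at h
    -- `z^{c₁} = k · z^{c₂} · k'⁻¹` ⇒ `z^{c₁ + c₂} = k · k'⁻¹`
    show zpow₂ z (c₁ y i + c₂ y i) = _
    rw [zpow₂_add hz2, h, mul_assoc, mul_assoc, ← zpow₂_comm hzc (c₂ y i),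
      ← mul_assoc (zpow₂ z (c₂ y i)), zpow₂_mul_self hz2, one_mul]
  have hcyc := zpow₂_sum_range_eq_of_link hzc hz2 hlink m L
  rw [ZMod.natCast_self, Pi.single_zero, mul_inv_cancel] at hcyc
  -- `z^{hol} = 1` with `z ≠ 1` forces `hol = 0`
  have hcases : ∀ a : ZMod 2, a = 0 ∨ a = 1 := by decide
  rcases hcases (cycleHolonomy (c₁ + c₂) m) with h | h
  · exact h
  · exfalso
    unfold cycleHolonomy at h
    rw [h] at hcyc
    simp only [zpow₂, if_true] at hcyc
    exact hz1 hcyc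

/-- ★★★ **The gauge classes of `{1, z}`-valued Kogut–Susskind staggerings of the torus are labelled by
the cycle holonomies**: for a central involution `z ≠ 1` and KS cochains `c₁, c₂` of `(ℤ/L)^d`
(`L ≥ 1`), `T₁ = k ∘ T₂` for some gauge function `k` iff all `d` cycle holonomies of `c₁ + c₂` vanish. -/
theorem IsTorusKSCochain.gauge_iff [NeZero L] {c₁ c₂ : TorusSite d L → Fin d → ZMod 2}
    (h₁ : IsTorusKSCochain c₁) (h₂ : IsTorusKSCochain c₂) (hzc : ∀ g : G, z * g = g * z)
    (hz2 : z * z = 1) (hz1 : z ≠ 1) :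
    (∃ k : TorusSite d L → G, ∀ U : GaugeConfig d L G, centralTwist (cochainTwist z c₁) U =
        gaugeTransform k (centralTwist (cochainTwist z c₂) U)) ↔
      ∀ m, cycleHolonomy (c₁ + c₂) m = 0 := by
  constructor
  · rintro ⟨k, hk⟩ m
    exact IsTorusKSCochain.cycleHolonomy_eq_zero_of_gauge hzc hz2 hz1 hk m
  · intro h0
    obtain ⟨k, -, hk⟩ := h₁.exists_gauge_of_cycleHolonomy_eq_zero h₂ hzc hz2 h0
    exact ⟨k, hk⟩

/-- ★ **Gauge-invariant observables do not distinguish KS staggerings of the same class.** -/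
theorem IsTorusKSCochain.apply_centralTwist_eq [NeZero L] {c₁ c₂ : TorusSite d L → Fin d → ZMod 2}
    (h₁ : IsTorusKSCochain c₁) (h₂ : IsTorusKSCochain c₂) (hzc : ∀ g : G, z * g = g * z)
    (hz2 : z * z = 1) (h0 : ∀ m, cycleHolonomy (c₁ + c₂) m = 0) {α : Type*}
    {F : GaugeConfig d L G → α} (hF : IsGaugeInvariant F) (U : GaugeConfig d L G) :
    F (centralTwist (cochainTwist z c₁) U) = F (centralTwist (cochainTwist z c₂) U) := by
  obtain ⟨k, -, hk⟩ := h₁.exists_gauge_of_cycleHolonomy_eq_zero h₂ hzc hz2 h0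
  rw [hk U, hF k]

end Gauge

/-! ## The `2^d` sectors: the parity cochain plus coordinate sheets -/

section Sectors

variable {z : G}

/-- **The parity cochain has trivial cycle holonomies**: along the cycle in direction `m` only the
parities `π_{m'}`, `m' ≺ m` (so `m' ≠ m`), of the points `t e_m` are read, and they vanish. -/
theorem cycleHolonomy_stagParity (h2 : 2 ∣ L) (r m : Fin d) :
    cycleHolonomy (fun y i => stagParity (cubicParity d L h2) r (y, i)) m = 0 := by
  unfold cycleHolonomy stagParity
  refine Finset.sum_eq_zero fun t _ => Finset.sum_eq_zero fun m' hm' => ?_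
  rw [Finset.mem_filter] at hm'
  dsimp only at hm' ⊢
  have hne : m' ≠ m := by
    rintro rfl
    exact hm'.2.2.elim hm'.2.1 (lt_irrefl _)
  rw [cubicParity_apply, Pi.single_eq_of_ne hne, map_zero]

/-- **The KS cochain of the sector `ε`**: the parity cochain plus the sheets `∑_m sheet m (ε m)`. -/
theorem isTorusKSCochain_sector (h2 : 2 ∣ L) (r : Fin d) (ε : Fin d → ZMod 2) :
    IsTorusKSCochain ((fun y i => stagParity (cubicParity d L h2) r (y, i)) + ∑ m, sheet m (ε m)) :=
  (isTorusKSCochain_stagParity h2 r).add_isClosed (isClosed_sum _ fun m _ => isClosed_sheet m _)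

/-- The sector cochain has cycle holonomies `ε` (`L ≥ 1`). -/
theorem cycleHolonomy_sector [NeZero L] (h2 : 2 ∣ L) (r : Fin d) (ε : Fin d → ZMod 2) (m : Fin d) :
    cycleHolonomy ((fun y i => stagParity (cubicParity d L h2) r (y, i)) + ∑ m, sheet m (ε m)) m = ε m := by
  rw [cycleHolonomy_add, cycleHolonomy_stagParity, zero_add, cycleHolonomy_sum]
  simp [cycleHolonomy_sheet]

/-- ★★ **Every KS staggering of the torus is gauge equivalent to the sector staggering of its own cycle
holonomies** (relative to the parity cochain; `L` even for the parity cochain to exist, central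
involution `z`). All `2^d` sectors occur. -/
theorem IsTorusKSCochain.exists_gauge_sector [NeZero L] (h2 : 2 ∣ L) (r : Fin d)
    {c : TorusSite d L → Fin d → ZMod 2} (hc : IsTorusKSCochain c) (hzc : ∀ g : G, z * g = g * z)
    (hz2 : z * z = 1) :
    ∃ k : TorusSite d L → G, (∀ y g, k y * g = g * k y) ∧ ∀ U : GaugeConfig d L G,
      centralTwist (cochainTwist z c) U = gaugeTransform k (centralTwist (cochainTwist z
        ((fun y i => stagParity (cubicParity d L h2) r (y, i)) + ∑ m, sheet m
          (cycleHolonomy (c + fun y i => stagParity (cubicParity d L h2) r (y, i)) m))) U) := by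
  refine hc.exists_gauge_of_cycleHolonomy_eq_zero (isTorusKSCochain_sector h2 r _) hzc hz2 fun m => ?_
  set p : TorusSite d L → Fin d → ZMod 2 := fun y i => stagParity (cubicParity d L h2) r (y, i)
  rw [← add_assoc, cycleHolonomy_add (c + p), cycleHolonomy_sum]
  simp only [cycleHolonomy_sheet, Finset.sum_ite_eq, Finset.mem_univ, if_true]
  have h : ∀ a : ZMod 2, a + a = 0 := by decide
  exact h _

/-- ★★ **The sector is unique**: two sector staggerings `ε, ε'` are gauge equivalent only if `ε = ε'`
(`z ≠ 1`): there are EXACTLY `2^d` gauge classes of `{1, z}`-valued KS staggerings on the even torus. -/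
theorem sector_unique [NeZero L] (h2 : 2 ∣ L) (r : Fin d) (hzc : ∀ g : G, z * g = g * z)
    (hz2 : z * z = 1) (hz1 : z ≠ 1) {ε ε' : Fin d → ZMod 2} {k : TorusSite d L → G}
    (hk : ∀ U : GaugeConfig d L G,
      centralTwist (cochainTwist z ((fun y i => stagParity (cubicParity d L h2) r (y, i)) +
        ∑ m, sheet m (ε m))) U =
      gaugeTransform k (centralTwist (cochainTwist z ((fun y i => stagParity (cubicParity d L h2) r (y, i)) +
        ∑ m, sheet m (ε' m))) U)) : ε = ε' := by
  funext m
  have h := IsTorusKSCochain.cycleHolonomy_eq_zero_of_gauge hzc hz2 hz1 hk m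
  rw [cycleHolonomy_add, cycleHolonomy_sector, cycleHolonomy_sector] at h
  have hab : ∀ a b : ZMod 2, a + b = 0 → a = b := by decide
  exact hab _ _ h

end Sectors

end TiltedRP

end Summit.QuantumFields.GaugeBoot
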